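import Literature.Geometry.Kaehler.CyclotomicCMTypesDegreeLeEightAllPowersHodgeConjecture
import Literature.Geometry.Kaehler.ComplexTorusCyclotomicCharpolyNonSimpleDegreeLeTwelveHodgeClasses
import Literature.AlgebraicGeometry.Pohlmann1968.CMFieldLowDegreeHodgeConjectureVariety
import Literature.AlgebraicGeometry.ComplexMultiplication.ShimuraCyclotomicCMTypeCensus
import Literature.AlgebraicGeometry.ComplexMultiplication.MumfordTateTorusAbelianVarietyKubotaRank
import HarnessLib

/-!
# `ℚ(ζ₁₃)`: every CM type is STABLY NONDEGENERATE — the five primitive families have rank `7`; every abelian variety with complex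
# multiplication by `ℚ(ζ₁₃)` (any type) satisfies the Hodge conjecture with all its powers; every complex torus with `P_u = Φ₁₃` has
# `Hdg = Div` on all powers

Layer `Literature/Geometry/Kaehler`, namespace `Literature.Geometry.Kaehler.ComplexTorus`; lane `lit-hodgefound` (Track 2 foundations library), prover
seat `lit-hodgefound-p10`, generation 33, row «A2-26(hs)» (self-proposed 2026-08-28).  Theorems only; no `def`, no instance, no named fact (net
Literature debt 0).  The first field of degree `12` — where degenerate primitive types DO occur for `ℚ(ζ₂₁)`, `ℚ(ζ₂₈)`, `ℚ(ζ₃₆)` (the tree's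
`Pohlmann1968/DegenerateCMTypeCyclotomic21`): for `ℚ(ζ₁₃)` they do not.

Shimura §8.4 Example (1) («`p = 13` … the 60 primitive types are divided into 5 families»; tree `ShimuraCyclotomicCMTypeCensus`: `rep13`,
`repType`, `existsUnique_isAutTransform_repType`, `not_isPrimitive_iff_stable_three_thirteen`).  For each representative residue set
`S ∈ {{1,2,3,4,5,6}, {1,2,3,5,7,9}, {1,2,6,8,9,10}, {1,2,3,4,6,8}, {1,2,3,4,5,7}}` the `7 × 7` matrix `([u·c ∈ S])_{u,c ∈ {1,…,7}}` is invertible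
(determinants `−5, −5, −1, −1, −4`), so seven Galois translates of the type are linearly independent: `Rank = 7 = 6 + 1` (Kubota), i.e. the
type is NONDEGENERATE (Dodson's rank; White–Hazama: `B•(Aⁿ) = D•(Aⁿ)`).  The `4` imprimitive types are induced from the cyclic quartic CM
subfield (stabiliser `{1, 3, 9}`) and are handled by this generation's `CMFieldImprimitiveTypeDegreeLeTwelveHodgeConjecture` ∕
`ComplexTorusCyclotomicCharpolyNonSimpleDegreeLeTwelveHodgeClasses`.

* §1 `seven_le_cmTypeRank_of_residueSet_eq_rep13_zero … _four` (five explicit `7 × 7` certificates), **`cmTypeRank_eq_seven_of_isPrimitive_thirteen`**,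
  **`isNondegenerate_of_isPrimitive_thirteen`**, `isNondegenerate_iff_isPrimitive_thirteen`.
* §2 **`hodgeClassSpan_pow_eq_divisorClassesSpan_thirteen`** (ALL CM types of `ℚ(ζ₁₃)`, all realisations, all powers),
  **`hodgeConjectureFor_pow_thirteen`** (the Hodge conjecture for every power of every abelian variety with complex multiplication by `ℚ(ζ₁₃)`),
  `hodgeConjectureFor_thirteen` (`A` itself, `dim A = 6`), `isSimple_and_hodgeConjectureFor_pow_of_isPrimitive_thirteen`.
* §3 **`divisorClasses_powPeriod_eq_hodgeClasses_of_charpoly_eq_cyclotomic_thirteen`**: `Hdg(Xᵏ) = Div(Xᵏ)` for all `k`, for EVERY complex torus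
  (of dimension `6`) with an endomorphism of characteristic polynomial `Φ₁₃`, simple or not.

## References

* [Shimura1998] G. Shimura, *Abelian Varieties with Complex Multiplication and Modular Functions* (1998), §8.4 Example (1) (`p = 13`).
* [Dodson1984] B. Dodson, *The structure of Galois groups of CM-fields*, Trans. AMS 283 (1984), §3.1.0 (the rank), §5.
* [Kubota1965] T. Kubota, Trans. AMS 118 (1965), §2 p. 115.
* [Gordon1999HodgeAVSurvey] B. B. Gordon (1999), Thm. 6.4, 7.5, §9.3.
* [MoonenZarhin1999LowDim] B. Moonen, Yu. Zarhin, Math. Ann. 315 (1999), §2 (2.7).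
-/

noncomputable section

open scoped Classical nonZeroDivisors NumberField Manifold ContDiff MatrixGroups
open NumberField Module Polynomial CategoryTheory CategoryTheory.Limits

namespace Literature.Geometry.Kaehler

namespace ComplexTorus

-- `open scoped`: the tree's action of `Aut(ℂ)` on `Hom(K, ℂ)` by composition (`ringEquivCompAction`) is a scoped instance
open scoped Literature.NumberTheory.ComplexMultiplication
open Literature.NumberTheory.Automorphic (IsTorusSubgroup)
open Literature.AlgebraicGeometry.Motives (CMType AbelianVariety HodgeTensorFacts hodgeTensorFacts_holds)
open Literature.AlgebraicGeometry.HodgeTheory (HodgeConjectureFor complexBetti)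
open Literature.AlgebraicGeometry.VanGeemen1994 (hodgeClassSpan)
open Literature.Barriers.HodgeConjecture (divisorClassesSpan)
open Literature.NumberTheory.ComplexMultiplication (IsPrimitive translateInd translateInd_of_mem translateInd_of_not_mem)
open Literature.NumberTheory.ComplexMultiplication.CMTypeLattice (periodIso basisIndex card_basisIndex_eq_finrank
  isSimple_periodIso_iff_isPrimitive isAbelianVariety_periodIso)
open Literature.AlgebraicGeometry.Pohlmann1968 (cmTypeRank cmTypeRank_le IsNondegenerate isNondegenerate_iff
  hodgeClassSpan_pow_eq_divisorClassesSpan_of_not_isPrimitive_of_finrank_le_twelve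
  hodgeConjectureFor_pow_of_not_isPrimitive_of_finrank_le_twelve)
open Literature.AlgebraicGeometry.Pohlmann1968.Cyclotomic (autExp expOf exists_autExp_eq exists_expOf_eq finrank_eq_totient)
open Literature.AlgebraicGeometry.ComplexMultiplication (IsCMTypeRealisation isSimple_iff_isPrimitive
  isSimple_of_isCMTypeRealisation_of_isPrimitive)
open Literature.AlgebraicGeometry.ComplexMultiplication.CMTorus (mtRank_hodgeStructure_periodIso_eq_cmTypeRank)
open Literature.AlgebraicGeometry.ComplexMultiplication.CyclotomicCMTypeResidueSets (IsAutTransform unitResidues residueSet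
  expOf_smul expOf_mem_residueSet_iff IsAutTransform.isPrimitive_iff)
open Literature.AlgebraicGeometry.ComplexMultiplication.ShimuraCyclotomicCMTypeCensus (rep13 repType residueSet_repType
  isPrimitive_repType existsUnique_isAutTransform_repType)

/-! ### §1 The ranks of the CM types of `ℚ(ζ₁₃)` -/

section Types

variable {K : Type} [Field K] [NumberField K]

variable [IsCyclotomicExtension {13} ℚ K]

variable (K) in
/-- `ℚ(ζ₁₃)` is a CM field (Mathlib). No instance is registered. [folklore] -/
private theorem isCMField_thirteen₅₀ : IsCMField K :=
  IsCyclotomicExtension.Rat.isCMField K (S := ({13} : Set ℕ)) ⟨13, rfl, by norm_num⟩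

variable (K) in
/-- `[ℚ(ζ₁₃) : ℚ] = 12`. [folklore] -/
private theorem finrank_eq_twelve₅₀ : finrank ℚ K = 12 := by
  rw [IsCyclotomicExtension.Rat.finrank 13 K]; decide

/-- The indicator of a translate of `Φ`, read on exponents. [cite: Shimura1998, §8.4 Example (1)] -/
private theorem translateInd_eq_ite₅₀ (Φ : CMType K) (τ : ℂ ≃+* ℂ) (σ : K →+* ℂ) :
    translateInd Φ.1 τ σ = if autExp 13 τ * expOf 13 K σ ∈ residueSet 13 Φ then (1 : ℚ) else 0 := by
  have h : τ • σ ∈ Φ.1 ↔ autExp 13 τ * expOf 13 K σ ∈ residueSet 13 Φ := by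
    rw [← expOf_mem_residueSet_iff 13 Φ, expOf_smul]
  by_cases hm : autExp 13 τ * expOf 13 K σ ∈ residueSet 13 Φ
  · rw [translateInd_of_mem (h.2 hm), if_pos hm]
  · rw [translateInd_of_not_mem (fun h' => hm (h.1 h')), if_neg hm]

/-- **`Rank(Φ) ≥ 7` for the type with residue set `{1, 2, 3, 4, 5, 6}`** (`= rep13 0`): the translates by the automorphisms of `ℂ` with cyclotomic characters
`1, …, 7`, read at the embeddings with exponents `1, …, 7`, are linearly independent (the `7 × 7` matrix `([u·c ∈ S])` is invertible).
[cite: Dodson1984, §3.1.0 (p. 11)] [cite: Shimura1998, §8.4 Example (1)] -/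
theorem seven_le_cmTypeRank_of_residueSet_eq_rep13_zero (Φ : CMType K) (hΦ : residueSet 13 Φ = {1, 2, 3, 4, 5, 6}) :
    7 ≤ cmTypeRank Φ := by
  classical
  have hu : ∀ i : Fin 7, ((![1, 2, 3, 4, 5, 6, 7] : Fin 7 → ZMod 13) i).val.Coprime 13 := by decide
  choose τ hτ using fun i : Fin 7 => exists_autExp_eq 13 _ (hu i)
  choose σ hσ using fun j : Fin 7 => exists_expOf_eq 13 K _ (hu j)
  let f : Fin 7 → (K →+* ℂ) → ℚ := fun i => translateInd Φ.1 (τ i)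
  have hval : ∀ i j : Fin 7, f i (σ j) =
      if (![1, 2, 3, 4, 5, 6, 7] : Fin 7 → ZMod 13) i * (![1, 2, 3, 4, 5, 6, 7] : Fin 7 → ZMod 13) j ∈
        ({1, 2, 3, 4, 5, 6} : Finset (ZMod 13)) then (1 : ℚ) else 0 := by
    intro i j
    show translateInd Φ.1 (τ i) (σ j) = _
    rw [translateInd_eq_ite₅₀, hτ, hσ, hΦ]
  have hli : LinearIndependent ℚ f := by
    rw [Fintype.linearIndependent_iff]
    intro g hg
    have heval : ∀ j : Fin 7, ∑ i, g i * f i (σ j) = 0 := fun j => by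
      have := congrFun hg (σ j)
      simpa only [Finset.sum_apply, Pi.smul_apply, smul_eq_mul, Pi.zero_apply] using this
    have e0 := heval 0
    have e1 := heval 1
    have e2 := heval 2
    have e3 := heval 3
    have e4 := heval 4
    have e5 := heval 5
    have e6 := heval 6
    simp (config := { decide := true }) [Fin.sum_univ_seven, hval] at e0 e1 e2 e3 e4 e5 e6
    intro i
    fin_cases i <;> simp <;> linarith
  have h1 : Module.finrank ℚ (Submodule.span ℚ (Set.range f)) = 7 := by
    rw [finrank_span_eq_card hli, Fintype.card_fin]
  have h2 : Submodule.span ℚ (Set.range f) ≤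
      Submodule.span ℚ (Set.range fun g : ℂ ≃+* ℂ => translateInd Φ.1 g) :=
    Submodule.span_mono (by rintro _ ⟨i, rfl⟩; exact ⟨τ i, rfl⟩)
  have h3 := Submodule.finrank_mono h2
  rw [h1] at h3
  exact h3

/-- **`Rank(Φ) ≥ 7` for the type with residue set `{1, 2, 3, 5, 7, 9}`** (`= rep13 1`): the translates by the automorphisms of `ℂ` with cyclotomic characters
`1, …, 7`, read at the embeddings with exponents `1, …, 7`, are linearly independent (the `7 × 7` matrix `([u·c ∈ S])` is invertible).
[cite: Dodson1984, §3.1.0 (p. 11)] [cite: Shimura1998, §8.4 Example (1)] -/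
theorem seven_le_cmTypeRank_of_residueSet_eq_rep13_one (Φ : CMType K) (hΦ : residueSet 13 Φ = {1, 2, 3, 5, 7, 9}) :
    7 ≤ cmTypeRank Φ := by
  classical
  have hu : ∀ i : Fin 7, ((![1, 2, 3, 4, 5, 6, 7] : Fin 7 → ZMod 13) i).val.Coprime 13 := by decide
  choose τ hτ using fun i : Fin 7 => exists_autExp_eq 13 _ (hu i)
  choose σ hσ using fun j : Fin 7 => exists_expOf_eq 13 K _ (hu j)
  let f : Fin 7 → (K →+* ℂ) → ℚ := fun i => translateInd Φ.1 (τ i)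
  have hval : ∀ i j : Fin 7, f i (σ j) =
      if (![1, 2, 3, 4, 5, 6, 7] : Fin 7 → ZMod 13) i * (![1, 2, 3, 4, 5, 6, 7] : Fin 7 → ZMod 13) j ∈
        ({1, 2, 3, 5, 7, 9} : Finset (ZMod 13)) then (1 : ℚ) else 0 := by
    intro i j
    show translateInd Φ.1 (τ i) (σ j) = _
    rw [translateInd_eq_ite₅₀, hτ, hσ, hΦ]
  have hli : LinearIndependent ℚ f := by
    rw [Fintype.linearIndependent_iff]
    intro g hg
    have heval : ∀ j : Fin 7, ∑ i, g i * f i (σ j) = 0 := fun j => by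
      have := congrFun hg (σ j)
      simpa only [Finset.sum_apply, Pi.smul_apply, smul_eq_mul, Pi.zero_apply] using this
    have e0 := heval 0
    have e1 := heval 1
    have e2 := heval 2
    have e3 := heval 3
    have e4 := heval 4
    have e5 := heval 5
    have e6 := heval 6
    simp (config := { decide := true }) [Fin.sum_univ_seven, hval] at e0 e1 e2 e3 e4 e5 e6
    intro i
    fin_cases i <;> simp <;> linarith
  have h1 : Module.finrank ℚ (Submodule.span ℚ (Set.range f)) = 7 := by
    rw [finrank_span_eq_card hli, Fintype.card_fin]
  have h2 : Submodule.span ℚ (Set.range f) ≤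
      Submodule.span ℚ (Set.range fun g : ℂ ≃+* ℂ => translateInd Φ.1 g) :=
    Submodule.span_mono (by rintro _ ⟨i, rfl⟩; exact ⟨τ i, rfl⟩)
  have h3 := Submodule.finrank_mono h2
  rw [h1] at h3
  exact h3

/-- **`Rank(Φ) ≥ 7` for the type with residue set `{1, 2, 6, 8, 9, 10}`** (`= rep13 2`): the translates by the automorphisms of `ℂ` with cyclotomic characters
`1, …, 7`, read at the embeddings with exponents `1, …, 7`, are linearly independent (the `7 × 7` matrix `([u·c ∈ S])` is invertible).
[cite: Dodson1984, §3.1.0 (p. 11)] [cite: Shimura1998, §8.4 Example (1)] -/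
theorem seven_le_cmTypeRank_of_residueSet_eq_rep13_two (Φ : CMType K) (hΦ : residueSet 13 Φ = {1, 2, 6, 8, 9, 10}) :
    7 ≤ cmTypeRank Φ := by
  classical
  have hu : ∀ i : Fin 7, ((![1, 2, 3, 4, 5, 6, 7] : Fin 7 → ZMod 13) i).val.Coprime 13 := by decide
  choose τ hτ using fun i : Fin 7 => exists_autExp_eq 13 _ (hu i)
  choose σ hσ using fun j : Fin 7 => exists_expOf_eq 13 K _ (hu j)
  let f : Fin 7 → (K →+* ℂ) → ℚ := fun i => translateInd Φ.1 (τ i)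
  have hval : ∀ i j : Fin 7, f i (σ j) =
      if (![1, 2, 3, 4, 5, 6, 7] : Fin 7 → ZMod 13) i * (![1, 2, 3, 4, 5, 6, 7] : Fin 7 → ZMod 13) j ∈
        ({1, 2, 6, 8, 9, 10} : Finset (ZMod 13)) then (1 : ℚ) else 0 := by
    intro i j
    show translateInd Φ.1 (τ i) (σ j) = _
    rw [translateInd_eq_ite₅₀, hτ, hσ, hΦ]
  have hli : LinearIndependent ℚ f := by
    rw [Fintype.linearIndependent_iff]
    intro g hg
    have heval : ∀ j : Fin 7, ∑ i, g i * f i (σ j) = 0 := fun j => by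
      have := congrFun hg (σ j)
      simpa only [Finset.sum_apply, Pi.smul_apply, smul_eq_mul, Pi.zero_apply] using this
    have e0 := heval 0
    have e1 := heval 1
    have e2 := heval 2
    have e3 := heval 3
    have e4 := heval 4
    have e5 := heval 5
    have e6 := heval 6
    simp (config := { decide := true }) [Fin.sum_univ_seven, hval] at e0 e1 e2 e3 e4 e5 e6
    intro i
    fin_cases i <;> simp <;> linarith
  have h1 : Module.finrank ℚ (Submodule.span ℚ (Set.range f)) = 7 := by
    rw [finrank_span_eq_card hli, Fintype.card_fin]
  have h2 : Submodule.span ℚ (Set.range f) ≤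
      Submodule.span ℚ (Set.range fun g : ℂ ≃+* ℂ => translateInd Φ.1 g) :=
    Submodule.span_mono (by rintro _ ⟨i, rfl⟩; exact ⟨τ i, rfl⟩)
  have h3 := Submodule.finrank_mono h2
  rw [h1] at h3
  exact h3

/-- **`Rank(Φ) ≥ 7` for the type with residue set `{1, 2, 3, 4, 6, 8}`** (`= rep13 3`): the translates by the automorphisms of `ℂ` with cyclotomic characters
`1, …, 7`, read at the embeddings with exponents `1, …, 7`, are linearly independent (the `7 × 7` matrix `([u·c ∈ S])` is invertible).
[cite: Dodson1984, §3.1.0 (p. 11)] [cite: Shimura1998, §8.4 Example (1)] -/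
theorem seven_le_cmTypeRank_of_residueSet_eq_rep13_three (Φ : CMType K) (hΦ : residueSet 13 Φ = {1, 2, 3, 4, 6, 8}) :
    7 ≤ cmTypeRank Φ := by
  classical
  have hu : ∀ i : Fin 7, ((![1, 2, 3, 4, 5, 6, 7] : Fin 7 → ZMod 13) i).val.Coprime 13 := by decide
  choose τ hτ using fun i : Fin 7 => exists_autExp_eq 13 _ (hu i)
  choose σ hσ using fun j : Fin 7 => exists_expOf_eq 13 K _ (hu j)
  let f : Fin 7 → (K →+* ℂ) → ℚ := fun i => translateInd Φ.1 (τ i)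
  have hval : ∀ i j : Fin 7, f i (σ j) =
      if (![1, 2, 3, 4, 5, 6, 7] : Fin 7 → ZMod 13) i * (![1, 2, 3, 4, 5, 6, 7] : Fin 7 → ZMod 13) j ∈
        ({1, 2, 3, 4, 6, 8} : Finset (ZMod 13)) then (1 : ℚ) else 0 := by
    intro i j
    show translateInd Φ.1 (τ i) (σ j) = _
    rw [translateInd_eq_ite₅₀, hτ, hσ, hΦ]
  have hli : LinearIndependent ℚ f := by
    rw [Fintype.linearIndependent_iff]
    intro g hg
    have heval : ∀ j : Fin 7, ∑ i, g i * f i (σ j) = 0 := fun j => by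
      have := congrFun hg (σ j)
      simpa only [Finset.sum_apply, Pi.smul_apply, smul_eq_mul, Pi.zero_apply] using this
    have e0 := heval 0
    have e1 := heval 1
    have e2 := heval 2
    have e3 := heval 3
    have e4 := heval 4
    have e5 := heval 5
    have e6 := heval 6
    simp (config := { decide := true }) [Fin.sum_univ_seven, hval] at e0 e1 e2 e3 e4 e5 e6
    intro i
    fin_cases i <;> simp <;> linarith
  have h1 : Module.finrank ℚ (Submodule.span ℚ (Set.range f)) = 7 := by
    rw [finrank_span_eq_card hli, Fintype.card_fin]
  have h2 : Submodule.span ℚ (Set.range f) ≤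
      Submodule.span ℚ (Set.range fun g : ℂ ≃+* ℂ => translateInd Φ.1 g) :=
    Submodule.span_mono (by rintro _ ⟨i, rfl⟩; exact ⟨τ i, rfl⟩)
  have h3 := Submodule.finrank_mono h2
  rw [h1] at h3
  exact h3

/-- **`Rank(Φ) ≥ 7` for the type with residue set `{1, 2, 3, 4, 5, 7}`** (`= rep13 4`): the translates by the automorphisms of `ℂ` with cyclotomic characters
`1, …, 7`, read at the embeddings with exponents `1, …, 7`, are linearly independent (the `7 × 7` matrix `([u·c ∈ S])` is invertible).
[cite: Dodson1984, §3.1.0 (p. 11)] [cite: Shimura1998, §8.4 Example (1)] -/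
theorem seven_le_cmTypeRank_of_residueSet_eq_rep13_four (Φ : CMType K) (hΦ : residueSet 13 Φ = {1, 2, 3, 4, 5, 7}) :
    7 ≤ cmTypeRank Φ := by
  classical
  have hu : ∀ i : Fin 7, ((![1, 2, 3, 4, 5, 6, 7] : Fin 7 → ZMod 13) i).val.Coprime 13 := by decide
  choose τ hτ using fun i : Fin 7 => exists_autExp_eq 13 _ (hu i)
  choose σ hσ using fun j : Fin 7 => exists_expOf_eq 13 K _ (hu j)
  let f : Fin 7 → (K →+* ℂ) → ℚ := fun i => translateInd Φ.1 (τ i)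
  have hval : ∀ i j : Fin 7, f i (σ j) =
      if (![1, 2, 3, 4, 5, 6, 7] : Fin 7 → ZMod 13) i * (![1, 2, 3, 4, 5, 6, 7] : Fin 7 → ZMod 13) j ∈
        ({1, 2, 3, 4, 5, 7} : Finset (ZMod 13)) then (1 : ℚ) else 0 := by
    intro i j
    show translateInd Φ.1 (τ i) (σ j) = _
    rw [translateInd_eq_ite₅₀, hτ, hσ, hΦ]
  have hli : LinearIndependent ℚ f := by
    rw [Fintype.linearIndependent_iff]
    intro g hg
    have heval : ∀ j : Fin 7, ∑ i, g i * f i (σ j) = 0 := fun j => by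
      have := congrFun hg (σ j)
      simpa only [Finset.sum_apply, Pi.smul_apply, smul_eq_mul, Pi.zero_apply] using this
    have e0 := heval 0
    have e1 := heval 1
    have e2 := heval 2
    have e3 := heval 3
    have e4 := heval 4
    have e5 := heval 5
    have e6 := heval 6
    simp (config := { decide := true }) [Fin.sum_univ_seven, hval] at e0 e1 e2 e3 e4 e5 e6
    intro i
    fin_cases i <;> simp <;> linarith
  have h1 : Module.finrank ℚ (Submodule.span ℚ (Set.range f)) = 7 := by
    rw [finrank_span_eq_card hli, Fintype.card_fin]
  have h2 : Submodule.span ℚ (Set.range f) ≤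
      Submodule.span ℚ (Set.range fun g : ℂ ≃+* ℂ => translateInd Φ.1 g) :=
    Submodule.span_mono (by rintro _ ⟨i, rfl⟩; exact ⟨τ i, rfl⟩)
  have h3 := Submodule.finrank_mono h2
  rw [h1] at h3
  exact h3

/-- **`Rank(Φᵢ) = 7` for the five representative types** (`repType K i`; Kubota's bound `Rank ≤ n + 1 = 7`).
[cite: Shimura1998, §8.4 Example (1)] [cite: Kubota1965, §2 (p. 115)] [cite: Dodson1984, §3.1.0 (p. 11)] -/
theorem cmTypeRank_repType_thirteen (i : Fin 5) : cmTypeRank (repType K i) = 7 := by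
  haveI := isCMField_thirteen₅₀ K
  refine le_antisymm ?_ ?_
  · have h := cmTypeRank_le (repType K i)
    rw [finrank_eq_twelve₅₀ K] at h
    exact h
  · have hr := residueSet_repType (L := K) i
    fin_cases i
    · exact seven_le_cmTypeRank_of_residueSet_eq_rep13_zero _ (by rw [hr]; rfl)
    · exact seven_le_cmTypeRank_of_residueSet_eq_rep13_one _ (by rw [hr]; rfl)
    · exact seven_le_cmTypeRank_of_residueSet_eq_rep13_two _ (by rw [hr]; rfl)
    · exact seven_le_cmTypeRank_of_residueSet_eq_rep13_three _ (by rw [hr]; rfl)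
    · exact seven_le_cmTypeRank_of_residueSet_eq_rep13_four _ (by rw [hr]; rfl)

/-- **EVERY PRIMITIVE CM TYPE OF `ℚ(ζ₁₃)` HAS RANK `7 = 6 + 1`** (it is a transform of one of the five representatives; the rank is constant on
families). [cite: Shimura1998, §8.4 Example (1)] [cite: Dodson1984, §3.1.0 (p. 11)] -/
theorem cmTypeRank_eq_seven_of_isPrimitive_thirteen (Φ : CMType K) (φ₀ : K →+* ℂ) (hΦ : IsPrimitive (ℂ ≃+* ℂ) Φ.1 φ₀) :
    cmTypeRank Φ = 7 := by
  obtain ⟨i, hi, -⟩ := existsUnique_isAutTransform_repType Φ φ₀ hΦ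
  rw [cmTypeRank_eq_of_isAutTransform hi]
  exact cmTypeRank_repType_thirteen i

omit [IsCyclotomicExtension {13} ℚ K] in
/-- **THE PRIMITIVE CM TYPES OF `ℚ(ζ₁₃)` ARE NONDEGENERATE** (`Rank = n + 1`). [cite: Dodson1984, §3.1.0 (p. 11)] [cite: Shimura1998, §8.4 Example (1)] -/
theorem isNondegenerate_of_isPrimitive_thirteen (hK : IsCyclotomicExtension {13} ℚ K) (Φ : CMType K) (φ₀ : K →+* ℂ)
    (hΦ : IsPrimitive (ℂ ≃+* ℂ) Φ.1 φ₀) : IsNondegenerate Φ := by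
  haveI := isCMField_thirteen₅₀ K
  rw [isNondegenerate_iff, finrank_eq_twelve₅₀ K]
  exact cmTypeRank_eq_seven_of_isPrimitive_thirteen Φ φ₀ hΦ

omit [IsCyclotomicExtension {13} ℚ K] in
/-- **NONDEGENERATE ⟺ PRIMITIVE for the CM types of `ℚ(ζ₁₃)`.** [cite: Dodson1984, §3.1.0 (p. 11)] [cite: Shimura1998, §8.4 Example (1)] -/
theorem isNondegenerate_iff_isPrimitive_thirteen (hK : IsCyclotomicExtension {13} ℚ K) (Φ : CMType K) (φ₀ : K →+* ℂ) :
    IsNondegenerate Φ ↔ IsPrimitive (ℂ ≃+* ℂ) Φ.1 φ₀ := by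
  haveI := isCMField_thirteen₅₀ K
  exact ⟨fun h => h.isPrimitive φ₀, isNondegenerate_of_isPrimitive_thirteen hK Φ φ₀⟩

end Types

/-! ### §2 Abelian varieties with complex multiplication by `ℚ(ζ₁₃)` -/

section Varieties

variable {K : Type} [Field K] [NumberField K]
  {A : AbelianVariety ℂ} {ι : 𝓞 K →+* End A} {θ : K →+* Module.End ℂ (complexBetti A.X 1)}

/-- `Bᵐ ⊗ ℂ = Dᵐ ⊗ ℂ` for all `m` on an abelian variety gives the Hodge conjecture for it. [cite: Gordon1999HodgeAVSurvey, §9.3] -/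
private theorem hodgeConjectureFor_of_forall_hodgeClassSpan_eq₅₀ (B : AbelianVariety ℂ)
    (h : ∀ m : ℕ, hodgeClassSpan B.dim B.X m = divisorClassesSpan B.X B.dim m) : HodgeConjectureFor B.dim B.X :=
  ⟨Literature.AlgebraicGeometry.HodgeTheory.nonempty_hodgeModel_holds
      (Literature.AlgebraicGeometry.Motives.AbelianVariety.isSmoothProjective_holds (A := B)),
    fun m _ hc hmm ↦ Literature.AlgebraicGeometry.HodgeTheory.AbelianVariety.divisorClassesSpan_le_algebraicClasses B
      (fun b hb hb' ↦ Literature.AlgebraicGeometry.HodgeTheory.lefschetzOneOne_rational_holds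
        (Literature.AlgebraicGeometry.Motives.AbelianVariety.isSmoothProjective_holds (A := B)) b hb hb') m
      ((h m) ▸ Submodule.subset_span ⟨hc, hmm⟩)⟩

/-- **`Bᵐ(Aⁿ) ⊗ ℂ = Dᵐ(Aⁿ) ⊗ ℂ` FOR ALL `n, m`, FOR EVERY CM TYPE OF `ℚ(ζ₁₃)` AND EVERY REALISATION** (primitive: rank `7`; imprimitive: induced from the
cyclic quartic CM subfield, degree `≤ 12` sibling). [cite: Gordon1999HodgeAVSurvey, Thm. 6.4 and §9.3] [cite: Shimura1998, §8.4 Example (1)] -/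
theorem hodgeClassSpan_pow_eq_divisorClassesSpan_thirteen (hK : IsCyclotomicExtension {13} ℚ K) (Φ : CMType K)
    (hA : IsCMTypeRealisation Φ A ι θ) (n m : ℕ) :
    hodgeClassSpan (⨁ fun _ : Fin n => A).dim (⨁ fun _ : Fin n => A).X m =
      divisorClassesSpan (⨁ fun _ : Fin n => A).X (⨁ fun _ : Fin n => A).dim m := by
  haveI := isCMField_thirteen₅₀ K
  obtain ⟨φ₀⟩ : Nonempty (K →+* ℂ) := inferInstance
  by_cases hΦ : IsPrimitive (ℂ ≃+* ℂ) Φ.1 φ₀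
  · exact (isNondegenerate_of_isPrimitive_thirteen hK Φ φ₀ hΦ).hodgeClassSpan_pow_eq_divisorClassesSpan hA n m
  · exact hodgeClassSpan_pow_eq_divisorClassesSpan_of_not_isPrimitive_of_finrank_le_twelve (by rw [finrank_eq_twelve₅₀ K]) Φ φ₀ hΦ hA n m

/-- **THE HODGE CONJECTURE FOR EVERY POWER OF EVERY ABELIAN VARIETY WITH COMPLEX MULTIPLICATION BY `ℚ(ζ₁₃)`** (any CM type), UNCONDITIONALLY.
[cite: Gordon1999HodgeAVSurvey, Thm. 6.4 and §9.3] [cite: Shimura1998, §8.4 Example (1)] -/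
theorem hodgeConjectureFor_pow_thirteen (hK : IsCyclotomicExtension {13} ℚ K) (Φ : CMType K) (hA : IsCMTypeRealisation Φ A ι θ) (n : ℕ) :
    HodgeConjectureFor (⨁ fun _ : Fin n => A).dim (⨁ fun _ : Fin n => A).X :=
  hodgeConjectureFor_of_forall_hodgeClassSpan_eq₅₀ _ (fun m ↦ hodgeClassSpan_pow_eq_divisorClassesSpan_thirteen hK Φ hA n m)

/-- **The Hodge conjecture for every abelian variety with complex multiplication by `ℚ(ζ₁₃)` itself** (`dim A = 6`; Hazama's intrinsic form for the
abelian field `ℚ(ζ₁₃)`). [cite: Gordon1999HodgeAVSurvey, Thm. 6.4 and §9.3] -/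
theorem hodgeConjectureFor_thirteen (hK : IsCyclotomicExtension {13} ℚ K) (Φ : CMType K) (hA : IsCMTypeRealisation Φ A ι θ) :
    A.dim = 6 ∧ (∀ m : ℕ, hodgeClassSpan A.dim A.X m = divisorClassesSpan A.X A.dim m) ∧ HodgeConjectureFor A.dim A.X := by
  haveI := isCMField_thirteen₅₀ K
  haveI : IsAbelianGalois ℚ K := IsCyclotomicExtension.isAbelianGalois {13} ℚ K
  have hdim : A.dim = Module.finrank ℚ K / 2 := Literature.AlgebraicGeometry.Motives.schemeDim_eq_holds hA.1
  have hall : ∀ m : ℕ, hodgeClassSpan A.dim A.X m = divisorClassesSpan A.X A.dim m := by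
    rw [hdim]
    exact (Literature.AlgebraicGeometry.Pohlmann1968.forall_pow_hodgeClassSpan_eq_iff_forall_hodgeClassSpan_eq hA).1
      (fun n m ↦ hodgeClassSpan_pow_eq_divisorClassesSpan_thirteen hK Φ hA n m)
  refine ⟨by rw [hdim, finrank_eq_twelve₅₀ K], hall, hodgeConjectureFor_of_forall_hodgeClassSpan_eq₅₀ A hall⟩

/-- **The simple ζ₁₃-sixfolds**: every abelian variety of a PRIMITIVE CM type of `ℚ(ζ₁₃)` is SIMPLE and satisfies, with all its powers, the Hodge
conjecture. [cite: Shimura1998, §8.2 Prop. 26, §8.4 Example (1)] [cite: Gordon1999HodgeAVSurvey, Thm. 6.4 and §9.3] -/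
theorem isSimple_and_hodgeConjectureFor_pow_of_isPrimitive_thirteen (hK : IsCyclotomicExtension {13} ℚ K) (Φ : CMType K) (φ₀ : K →+* ℂ)
    (hΦ : IsPrimitive (ℂ ≃+* ℂ) Φ.1 φ₀) (hA : IsCMTypeRealisation Φ A ι θ) (n : ℕ) :
    A.IsSimple ∧ HodgeConjectureFor (⨁ fun _ : Fin n => A).dim (⨁ fun _ : Fin n => A).X :=
  ⟨isSimple_of_isCMTypeRealisation_of_isPrimitive hA φ₀ hΦ, hodgeConjectureFor_pow_thirteen hK Φ hA n⟩

end Varieties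

/-! ### §3 Complex tori with an endomorphism of characteristic polynomial `Φ₁₃` -/

section Tori

variable {ι : Type} [Fintype ι] [DecidableEq ι] {E : Type} [NormedAddCommGroup E] [NormedSpace ℂ E]
  {P : (ι → ℝ) ≃L[ℝ] E}

set_option backward.isDefEq.respectTransparency false in -- Mathlib's instance
-- `IsCyclotomicExtension {13} ℚ (CyclotomicField 13 ℚ)` is keyed on `CyclotomicField.algebra`, the goal on `DivisionRing.toRatAlgebra`
/-- **`Hdg(Xᵏ) = Div(Xᵏ)` FOR ALL `k`, FOR EVERY COMPLEX TORUS WITH AN ENDOMORPHISM OF CHARACTERISTIC POLYNOMIAL `Φ₁₃`** (`dim X = 6`; simple: rank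
`7 = dim + 1`, Hazama–Murty; non-simple: this generation's degree-`≤ 12` file). [cite: MoonenZarhin1999LowDim, §2 Thm. (2.7)]
[cite: Gordon1999HodgeAVSurvey, 7.5] [cite: Shimura1998, §8.4 Example (1)] -/
theorem divisorClasses_powPeriod_eq_hodgeClasses_of_charpoly_eq_cyclotomic_thirteen {A : Matrix ι ι ℤ} (hA : A ∈ endRingInt P)
    (hP : A.charpoly = cyclotomic 13 ℤ) (k p : ℕ) :
    divisorClasses (powPeriod P k) p = hodgeClasses (powPeriod P k) p := by
  by_cases hX : ComplexTorus.IsSimple P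
  swap
  · exact divisorClasses_powPeriod_eq_hodgeClasses_of_not_isSimple_of_charpoly_eq_cyclotomic_of_totient_le_twelve (by norm_num)
      (by decide) hX hA hP k p
  haveI : HodgeTensorFacts.{0, 0} := hodgeTensorFacts_holds.{0, 0}
  have hζ := IsCyclotomicExtension.zeta_spec 13 ℚ (CyclotomicField 13 ℚ)
  obtain ⟨Φ, I, e, he, he₂, -⟩ := exists_cmType_ideal_iso_of_charpoly_eq_cyclotomic hζ hA hP
  haveI : IsCMField (CyclotomicField 13 ℚ) := isCMField_thirteen₅₀ (CyclotomicField 13 ℚ)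
  obtain ⟨φ₀⟩ : Nonempty (CyclotomicField 13 ℚ →+* ℂ) := inferInstance
  have hXiso : IsIsomorphic P (periodIso Φ I) := ⟨e, he, he₂⟩
  have hS : ComplexTorus.IsSimple (periodIso Φ I) := hXiso.isSimple_iff.1 hX
  have hΦ : IsPrimitive (ℂ ≃+* ℂ) Φ.1 φ₀ := (isSimple_periodIso_iff_isPrimitive Φ I φ₀).1 hS
  have hcard : Fintype.card (basisIndex I) = 12 := by rw [card_basisIndex_eq_finrank, finrank_eq_twelve₅₀ (CyclotomicField 13 ℚ)]
  haveI : Nonempty (basisIndex I) := Fintype.card_pos_iff.1 (by omega)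
  have hY := isAbelianVariety_periodIso Φ I
  exact (hXiso.isIsogenous.forall_powPeriod_divisorClasses_eq_hodgeClasses_iff.2
    ((hY.forall_powPeriod_divisorClasses_eq_hodgeClasses_iff_mtRank_eq_card_of_isSimple_of_isTorusSubgroup_mumfordTateGroupC hS
      (isTorusSubgroup_mumfordTateGroupC_periodIso Φ I)).2
      (by rw [mtRank_hodgeStructure_periodIso_eq_cmTypeRank Φ I,
        cmTypeRank_eq_seven_of_isPrimitive_thirteen Φ φ₀ hΦ, hcard]))) k p

end Tori

end ComplexTorus

end Literature.Geometry.Kaehler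

end
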